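import Summits.CriticalPhenomena.PercolationContinuityZ3.Theorems.PercNearOneGluingNoHeavyLowerTailSahiE3AndOrExch1DispatchKP
import Summits.CriticalPhenomena.PercolationContinuityZ3.Theorems.PercNearOneGluingNoHeavyLowerTailSahiE3AndOrExch1DispatchKA
import Summits.CriticalPhenomena.PercolationContinuityZ3.Theorems.PercNearOneGluingNoHeavyLowerTailSahiE3AndOrExch1DispatchKB
import Summits.CriticalPhenomena.PercolationContinuityZ3.Theorems.PercNearOneGluingNoHeavyLowerTailSahiE3AndOrExch1DispatchKV
import Mathlib.Tactic
import HarnessLib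
import HarnessLib.Audit

/-!
# `NoHeavyLowerTail` (crux stmt-CriticalPhenomena-4575), Sahi programme P4: flagship block `x₀∧(x₁∨x₂)`, level-`∅` exchange lemma (bracket type 1, i.e. `D₁`) — the theorem

Generated support file (cell `prim-l12`, seat P4, generation 23; generator HOME prim-l12-p4/code/gen23/asm/genasm.py;
`--supports stmt-CriticalPhenomena-4575`; tool lemmas of `…SahiE3AndOrTools` inlined in generation 26).  No named facts, no sorries; standard axioms; def-free.
The level-`∅` exchange inequality `EXCH ≥ 0` (bracket type as in the title) of the OR-peel for the block `V = x₀∧(x₁∨x₂) ⊂ Bool³` (product weight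
`μ = (A|1−A)(b|1−b)(c|1−c)`), for every configuration of up-sets `O ⊆ K∩L`, `K∪L ⊆ P` (and primed) and every certificate `R ≥ 0`
satisfying the pair inequalities of all admissible pairs (`hRpair`), is assembled by a case split on the traces `X ∩ V`
(memo FROM-prim-l12-p4-gen23-FLAGSHIP-LEVEL0.md §6): empty layers → `exchange_of_emptyLayer*`, no crossing →
`exchange_of_noCross₂/₁`, crossing with all four traces non-empty (60 patterns) → `exchange_of_hats` at the saturations + the trace
polynomial `andorPolyNN_nonneg` (corners handled through `O ⊆ K∩L`).
-/

set_option maxRecDepth 400000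
set_option linter.unusedSimpArgs false

namespace Summit.CriticalPhenomena.PercolationContinuityZ3.Theorems.SahiE3AndOrExch1

open Finset
open Summit.CriticalPhenomena.PercolationContinuityZ3.Theorems.SahiE3AndOrBlock
open scoped BigOperators

/-- **The level-`∅` exchange lemma (bracket type 1) for the flagship block `x₀∧(x₁∨x₂)`.**  For the product weight
`μ = (A|1−A)(b|1−b)(c|1−c)` on `Bool³`, every certificate `R ≥ 0` satisfying the pair inequality
`μ(X)μ(Y∩V) + μ(Y)μ(X∩V) − μ(V)μ(X)μ(Y) ≤ R(X∩Y∩V)` for all up-closed `X, Y`, and every configuration of up-closed sets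
`O ⊆ K∩L`, `K∪L ⊆ P`, `O' ⊆ K'∩L'`, `K'∪L' ⊆ P'`:
`w(PP'V)+w(OO'V) − w(P)w(O'V) − w(P')w(OV) + R(KK'V)+R(LL'V) − need(K,L') − need(L,K') + (1−v)·Y ≥ 0` with `Y = Har(P,P') + (p−k)(p'−l') + (p−l)(p'−k')` (type 2) resp. `Har(P,P') + (p−k)(k'−o') + (p−o)(p'−k')` (type 1).
[this work] -/
theorem exch1_andor (A b c : ℝ) (hA0 : 0 ≤ A) (hA1 : A ≤ 1) (hb0 : 0 ≤ b) (hb1 : b ≤ 1) (hc0 : 0 ≤ c) (hc1 : c ≤ 1)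
    (μ : (Fin 3 → Bool) → ℝ) (hμ : ∀ x, μ x = (if x 0 then A else 1 - A) * ((if x 1 then b else 1 - b) * (if x 2 then c else 1 - c)))
    (R : (Fin 3 → Bool) → ℝ) (hR0 : ∀ x, 0 ≤ R x)
    (hRpair : ∀ X Y : Finset (Fin 3 → Bool), (∀ a ∈ X, ∀ b : Fin 3 → Bool, a ≤ b → b ∈ X) → (∀ a ∈ Y, ∀ b : Fin 3 → Bool, a ≤ b → b ∈ Y) →
      (∑ x ∈ X, μ x) * (∑ x ∈ Y ∩ ({![true, true, false], ![true, false, true], ![true, true, true]} : Finset (Fin 3 → Bool)), μ x) + (∑ x ∈ Y, μ x) * (∑ x ∈ X ∩ ({![true, true, false], ![true, false, true], ![true, true, true]} : Finset (Fin 3 → Bool)), μ x) - (∑ x ∈ ({![true, true, false], ![true, false, true], ![true, true, true]} : Finset (Fin 3 → Bool)), μ x) * (∑ x ∈ X, μ x) * (∑ x ∈ Y, μ x)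
        ≤ ∑ x ∈ (X ∩ Y) ∩ ({![true, true, false], ![true, false, true], ![true, true, true]} : Finset (Fin 3 → Bool)), R x)
    (P K L O P' K' L' O' : Finset (Fin 3 → Bool))
    (hP : (∀ a ∈ P, ∀ b : Fin 3 → Bool, a ≤ b → b ∈ P)) (hK : (∀ a ∈ K, ∀ b : Fin 3 → Bool, a ≤ b → b ∈ K))
    (hL : (∀ a ∈ L, ∀ b : Fin 3 → Bool, a ≤ b → b ∈ L)) (hO : (∀ a ∈ O, ∀ b : Fin 3 → Bool, a ≤ b → b ∈ O))
    (hP' : (∀ a ∈ P', ∀ b : Fin 3 → Bool, a ≤ b → b ∈ P')) (hK' : (∀ a ∈ K', ∀ b : Fin 3 → Bool, a ≤ b → b ∈ K'))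
    (hL' : (∀ a ∈ L', ∀ b : Fin 3 → Bool, a ≤ b → b ∈ L')) (hO' : (∀ a ∈ O', ∀ b : Fin 3 → Bool, a ≤ b → b ∈ O'))
    (hKP : K ⊆ P) (hLP : L ⊆ P) (hOK : O ⊆ K) (hOL : O ⊆ L) (hKP' : K' ⊆ P') (hLP' : L' ⊆ P') (hOK' : O' ⊆ K') (hOL' : O' ⊆ L') :
    0 ≤ (∑ x ∈ (P ∩ P') ∩ ({![true, true, false], ![true, false, true], ![true, true, true]} : Finset (Fin 3 → Bool)), μ x) + (∑ x ∈ (O ∩ O') ∩ ({![true, true, false], ![true, false, true], ![true, true, true]} : Finset (Fin 3 → Bool)), μ x)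
        - (∑ x ∈ P, μ x) * (∑ x ∈ O' ∩ ({![true, true, false], ![true, false, true], ![true, true, true]} : Finset (Fin 3 → Bool)), μ x) - (∑ x ∈ P', μ x) * (∑ x ∈ O ∩ ({![true, true, false], ![true, false, true], ![true, true, true]} : Finset (Fin 3 → Bool)), μ x)
        + (∑ x ∈ (K ∩ K') ∩ ({![true, true, false], ![true, false, true], ![true, true, true]} : Finset (Fin 3 → Bool)), R x) + (∑ x ∈ (L ∩ L') ∩ ({![true, true, false], ![true, false, true], ![true, true, true]} : Finset (Fin 3 → Bool)), R x)
        - ((∑ x ∈ K, μ x) * (∑ x ∈ L' ∩ ({![true, true, false], ![true, false, true], ![true, true, true]} : Finset (Fin 3 → Bool)), μ x) + (∑ x ∈ L', μ x) * (∑ x ∈ K ∩ ({![true, true, false], ![true, false, true], ![true, true, true]} : Finset (Fin 3 → Bool)), μ x)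
            - (∑ x ∈ ({![true, true, false], ![true, false, true], ![true, true, true]} : Finset (Fin 3 → Bool)), μ x) * (∑ x ∈ K, μ x) * (∑ x ∈ L', μ x))
        - ((∑ x ∈ L, μ x) * (∑ x ∈ K' ∩ ({![true, true, false], ![true, false, true], ![true, true, true]} : Finset (Fin 3 → Bool)), μ x) + (∑ x ∈ K', μ x) * (∑ x ∈ L ∩ ({![true, true, false], ![true, false, true], ![true, true, true]} : Finset (Fin 3 → Bool)), μ x)
            - (∑ x ∈ ({![true, true, false], ![true, false, true], ![true, true, true]} : Finset (Fin 3 → Bool)), μ x) * (∑ x ∈ L, μ x) * (∑ x ∈ K', μ x))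
        + (1 - ∑ x ∈ ({![true, true, false], ![true, false, true], ![true, true, true]} : Finset (Fin 3 → Bool)), μ x) * (((∑ x ∈ P ∩ P', μ x) - (∑ x ∈ P, μ x) * (∑ x ∈ P', μ x))
            + ((∑ x ∈ P, μ x) - ∑ x ∈ K, μ x) * ((∑ x ∈ K', μ x) - ∑ x ∈ O', μ x)
            + ((∑ x ∈ P, μ x) - ∑ x ∈ O, μ x) * ((∑ x ∈ P', μ x) - ∑ x ∈ K', μ x)) := by
  rcases trace_cases K hK with hTK | hTK | hTK | hTK | hTK
  · exact br1_emptyK A b c hA0 hA1 hb0 hb1 hc0 hc1 μ hμ R hR0 hRpair P K L O P' K' L' O' hP hK hL hO hP' hK' hL' hO' hKP hLP hOK hOL hKP' hLP' hOK' hOL' hTK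
  · exact exch1_andor_KP A b c hA0 hA1 hb0 hb1 hc0 hc1 μ hμ R hR0 hRpair P K L O P' K' L' O' hP hK hL hO hP' hK' hL' hO' hKP hLP hOK hOL hKP' hLP' hOK' hOL' hTK
  · exact exch1_andor_KA A b c hA0 hA1 hb0 hb1 hc0 hc1 μ hμ R hR0 hRpair P K L O P' K' L' O' hP hK hL hO hP' hK' hL' hO' hKP hLP hOK hOL hKP' hLP' hOK' hOL' hTK
  · exact exch1_andor_KB A b c hA0 hA1 hb0 hb1 hc0 hc1 μ hμ R hR0 hRpair P K L O P' K' L' O' hP hK hL hO hP' hK' hL' hO' hKP hLP hOK hOL hKP' hLP' hOK' hOL' hTK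
  · exact exch1_andor_KV A b c hA0 hA1 hb0 hb1 hc0 hc1 μ hμ R hR0 hRpair P K L O P' K' L' O' hP hK hL hO hP' hK' hL' hO' hKP hLP hOK hOL hKP' hLP' hOK' hOL' hTK

end Summit.CriticalPhenomena.PercolationContinuityZ3.Theorems.SahiE3AndOrExch1
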